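import Summits.Langlands.Langlands.Theses.RootDecomp2
import Summits.Langlands.Langlands.Theorems.RetentionCarvingMonodromyFreeRigidity

/-!
# lens-6 g18 NODE `PadicFibreCarving` — the p-adic (ℓ = p, v ∣ ℓ) open-orbit residual
GEN_p = `RootDecomp2.GenericFibreAtP` (stmt-Langlands-26482, crux r7 of route-Langlands-RootDecomp2 rev 0
@bea569df4636) carved by the AVATAR SECTOR of (K, π, n) at p, plus the kernel-certified RETENTION
refinement: modulo S_p (26481) ∧ RECGEN (25108) ∧ MFR (27962, proved) ∧ CRD (17930), each cell's only
content sits at the MONODROMIC places v ∣ ℓ (rec(π_v) has N ≠ 0) — the v ∣ ℓ twin of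
`Literature.Barriers.Langlands.MonodromyNotClosedUnderPadicLimits` (N ≠ 0 is an open, not closed,
condition in p-adic families: scope caveat (a) = the v ∣ ℓ twin, Bloch–Kato Ex. 3.9; evasions (i) geometry / (ii) automorphy
lifting / (iii) p-adic Mazur principle / (iv) an independent lower bound on rk N), the barrier the host carving RootDecomp2 was cut along.

decomp-langlands · lens 6 «barrier-complement carving» · generation 18 · 2026-08-30.
Imports the LIVE host route module (rev 0) and the landed proof of MFR; every host item is used BY NAME.

## Pieces (all `def … : Prop`, inlined verbatim over the host vocabulary; tags in the docstrings)
* GEN_p ⟺ LOW ∧ CMH ∧ HR ∧ DK (`genericFibreAtP_iff_cells`, three excluded middles, EXACT mod nothing) — the four FILED children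
  (item cap 15 = 10 host items + 4 + glue); LOW ⟺ TR2 ∧ CMW (`low_iff_fine`, node sub-cells); each cell WEAKER (`…_of_genericFibreAtP`);
  split glue `GenericFibreAtP_of_split` (pure logic).
* Retention layer: `RetAt P` (= GEN_p on sector P at monodromic places only, given Rec, π_v ∈ π, S ∈ rec class,
  tr rℂ = tr S, S.N ≠ 0) with `retAt_of_genAt` (WEAKER) and `genAt_of_retAt : CRD → S_p → RECGEN → RetAt P → GenAt P`
  (MFR supplied by `Theorems.MonodromyFreeRigidity_proof`): the N = 0 places of every cell are CLOSED in the tree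
  modulo the named host items.
* `closes` : host binders with GEN_p replaced by the four cells ⟹ `_root_.Langlands` (via `RootDecomp2.closes`); `closes_retention`, `closes_fine`.
-/

set_option linter.dupNamespace false

namespace Summit.Langlands.Langlands.Theses.PadicFibreCarving

open scoped BigOperators Topology Manifold Classical MeasureTheory ProbabilityTheory Matrix InnerProductSpace ComplexConjugate ContinuousMap
open Filter Set Function TopologicalSpace MeasureTheory

/-! ## -1. Local algebra: traces under Frobenius-semisimplification, isomorphism, transport of scalars
(three folklore lemmas; the tree copies `WeilDeligneRep.IsFrobSemisimplificationOf.trace_eq`,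
`WeilDeligneRep.IsEquivalent.trace_eq`, `WeilDeligneRep.IsTransportAlong.trace_eq` live in
`Literature.NumberTheory.Automorphic.VarmaLocalGlobalPrecIProofs`, not built on the farm snapshot — re-proved here verbatim) -/

namespace Aux

open Literature.NumberTheory.GaloisRepresentations

variable {F : Type*} [Field F] [ValuativeRel F] [TopologicalSpace F] [IsNonarchimedeanLocalField F]
variable {C : Type*} [Field C] [CharZero C] {V : Type*} [AddCommGroup V] [Module C V]
  {V' : Type*} [AddCommGroup V'] [Module C V']

/-- Frobenius-semisimplification does not change Weil traces (the nilpotent difference is traceless).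
[cite: DeligneAntwerpII1973, §8.6] -/
theorem frobSemisimplification_trace_eq {r' r : WeilDeligneRep F C V} (h : r'.IsFrobSemisimplificationOf r)
    (w : WeilGroup F) : LinearMap.trace C V (r'.ρ w) = LinearMap.trace C V (r.ρ w) := by
  obtain ⟨m, hm, -, hw⟩ := (h.2.2 w).2
  rw [hw, map_add, (LinearMap.isNilpotent_trace_of_isNilpotent hm).eq_zero, add_zero]

/-- Isomorphic Weil–Deligne representations have equal Weil traces. [cite: DeligneAntwerpII1973, §8.4.1] -/
theorem isEquivalent_trace_eq {r : WeilDeligneRep F C V} {r' : WeilDeligneRep F C V'} (h : r.IsEquivalent r')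
    (w : WeilGroup F) : LinearMap.trace C V (r.ρ w) = LinearMap.trace C V' (r'.ρ w) := by
  obtain ⟨e⟩ := h
  rw [← Representation.Equiv.conj_apply_self w e.toRepEquiv, LinearMap.trace_conj']

/-- Transport of scalars along `ι : E →+* C` maps Weil traces. [cite: DeligneAntwerpII1973, §8.4.3] -/
theorem isTransportAlong_trace_eq {E : Type*} [Field E] [CharZero E] {n : ℕ} {ι : E →+* C}
    {r : WeilDeligneRep F E (Fin n → E)} {r' : WeilDeligneRep F C (Fin n → C)} (h : r.IsTransportAlong ι r')
    (w : WeilGroup F) :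
    LinearMap.trace C (Fin n → C) (r'.ρ w) = ι (LinearMap.trace E (Fin n → E) (r.ρ w)) := by
  rw [LinearMap.trace_eq_matrix_trace C (Pi.basisFun C (Fin n)),
    LinearMap.trace_eq_matrix_trace E (Pi.basisFun E (Fin n)), LinearMap.toMatrix_eq_toMatrix',
    LinearMap.toMatrix_eq_toMatrix', h.1 w, AddMonoidHom.map_trace]

end Aux

/-! ## 0. Sector calculus (node-internal; the filed items below inline everything) -/

/-- A sector predicate on the automorphic datum (K, n, π). -/
def Sector : Type 1 :=
  ∀ (K : Type) [Field K] [NumberField K] (n : ℕ)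
    (hcpt : Literature.NumberTheory.Automorphic.isCompact_glFiniteIntegralLevel n K),
    Literature.NumberTheory.Automorphic.CuspidalAutomorphicRepData n K hcpt → Prop

/-- GEN_p restricted to the sector `P` (GEN_p's text verbatim with `P K n hcpt π →` inserted after L-algebraicity). -/
def GenAt (P : Sector) : Prop :=
  ∀ (K : Type) [Field K] [NumberField K] (n : ℕ) (hcpt : Literature.NumberTheory.Automorphic.isCompact_glFiniteIntegralLevel n K), 0 < n → ∀ (π : Literature.NumberTheory.Automorphic.CuspidalAutomorphicRepData n K hcpt), π.1.IsLAlgebraic → P K n hcpt π → ∀ (ℓ : ℕ) [Fact ℓ.Prime] (ι : PadicAlgCl ℓ ≃+* ℂ) (ρ : Literature.NumberTheory.GaloisRepresentations.FramedGaloisRep K (PadicAlgCl ℓ) n), ρ.toGaloisRep.IsIrreducible → ((∀ᶠ v : IsDedekindDomain.HeightOneSpectrum (NumberField.RingOfIntegers K) in Filter.cofinite, ρ.IsUnramifiedAt v) ∧ ∀ (v : IsDedekindDomain.HeightOneSpectrum (NumberField.RingOfIntegers K)) (hv : ((ℓ : ℕ) : NumberField.RingOfIntegers K) ∈ v.asIdeal),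 (Literature.NumberTheory.PAdicHodge.fontainePstAdicCompletion v ℓ hv).IsDeRhamFramed (ρ.toLocal v)) → (∀ᶠ v : IsDedekindDomain.HeightOneSpectrum (NumberField.RingOfIntegers K) in Filter.cofinite, SatakeFrobCompatibleAt ι π.1 ρ v) → ∀ (v : IsDedekindDomain.HeightOneSpectrum (NumberField.RingOfIntegers K)) (hv : ((ℓ : ℕ) : NumberField.RingOfIntegers K) ∈ v.asIdeal), ∀ (r : Literature.NumberTheory.GaloisRepresentations.WeilDeligneRep (v.adicCompletion K) (PadicAlgCl ℓ) (Fin n → PadicAlgCl ℓ)) (rℂ r₁ : Literature.NumberTheory.GaloisRepresentations.WeilDeligneRep (v.adicCompletion K) ℂ (Fin n → ℂ)), (Literature.NumberTheory.PAdicHodge.fontainePstAdicCompletion v ℓ hv).IsWeilDeligneOf (ρ.toLocal v) r → r.IsTransportAlong (ι : PadicAlgCl ℓ →+* ℂ) rℂ → r₁.IsFrobSemisimplificationOf rℂ → ∀ f : (Fin n → ℂ) →ₗ[ℂ] (Fin n → ℂ), (∀ w : Literature.NumberTheory.GaloisRepresentations.WeilGroup (v.adicCompletion K), f ∘ₗ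 r₁.ρ w = ((Literature.NumberTheory.GaloisRepresentations.IsNonarchimedeanLocalField.residueFieldCard (v.adicCompletion K) : ℂ) ^ (Literature.NumberTheory.GaloisRepresentations.WeilGroup.deg w)) • (r₁.ρ w ∘ₗ f)) → f ∘ₗ r₁.N = r₁.N ∘ₗ f → f = 0

/-- RETENTION FORM on the sector `P`: GEN_p's conclusion demanded only at MONODROMIC places v ∣ ℓ — given reciprocity
data `Rec`, a local component `πv` of `π` at `v`, a Frobenius-semisimple `S` in the class `rec_v(π_v)` with `S.N ≠ 0`
whose Weil traces are those of the ℂ-transport `rℂ` of the pinned fibre `r` (the ℓ = p twin of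
`RetentionCarving.MonodromyRetention`, stmt-Langlands-27961). -/
def RetAt (P : Sector) : Prop :=
  ∀ (K : Type) [Field K] [NumberField K] (Rec : ReciprocityData K) (n : ℕ) (hcpt : Literature.NumberTheory.Automorphic.isCompact_glFiniteIntegralLevel n K), 0 < n → ∀ (π : Literature.NumberTheory.Automorphic.CuspidalAutomorphicRepData n K hcpt), π.1.IsLAlgebraic → P K n hcpt π → ∀ (ℓ : ℕ) [Fact ℓ.Prime] (ι : PadicAlgCl ℓ ≃+* ℂ) (ρ : Literature.NumberTheory.GaloisRepresentations.FramedGaloisRep K (PadicAlgCl ℓ) n), ρ.toGaloisRep.IsIrreducible → ((∀ᶠ v : IsDedekindDomain.HeightOneSpectrum (NumberField.RingOfIntegers K) in Filter.cofinite, ρ.IsUnramifiedAt v) ∧ ∀ (v : IsDedekindDomain.HeightOneSpectrum (NumberField.RingOfIntegers K)) (hv : ((ℓ : ℕ) : NumberField.RingOfIntegers K) ∈ v.asIdeal), (Literature.NumberTheory.PAdicHodge.fontainePstAdicCompletion v ℓ hv).IsDeRhamFramed (ρ.toLocal v)) → (∀ᶠ v : IsDedekindDomain.HeightOneSpectrum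 (NumberField.RingOfIntegers K) in Filter.cofinite, SatakeFrobCompatibleAt ι π.1 ρ v) → ∀ (v : IsDedekindDomain.HeightOneSpectrum (NumberField.RingOfIntegers K)) (hv : ((ℓ : ℕ) : NumberField.RingOfIntegers K) ∈ v.asIdeal) (πv : Literature.NumberTheory.Automorphic.SmoothIrrep (Matrix.GeneralLinearGroup (Fin n) (v.adicCompletion K))), π.1.HasLocalComponentAt v πv.ρ → ∀ (r : Literature.NumberTheory.GaloisRepresentations.WeilDeligneRep (v.adicCompletion K) (PadicAlgCl ℓ) (Fin n → PadicAlgCl ℓ)) (rℂ r₁ : Literature.NumberTheory.GaloisRepresentations.WeilDeligneRep (v.adicCompletion K) ℂ (Fin n → ℂ)), (Literature.NumberTheory.PAdicHodge.fontainePstAdicCompletion v ℓ hv).IsWeilDeligneOf (ρ.toLocal v) r → r.IsTransportAlong (ι : PadicAlgCl ℓ →+* ℂ) rℂ → ∀ (S : Literature.NumberTheory.GaloisRepresentations.WeilDeligneRep (v.adicCompletion K) ℂ (Fin n → ℂ)) (hS : S.IsFrobSemisimple), Quotient.mk (Literature.NumberTheory.Automorphic.frobSemisimpleWDSetoid (v.adicCompletion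 K) n) ⟨S, hS⟩ = (Rec.llc v).recGL n (Literature.NumberTheory.Automorphic.IrrClass.mk πv) → (∀ w : Literature.NumberTheory.GaloisRepresentations.WeilGroup (v.adicCompletion K), LinearMap.trace ℂ (Fin n → ℂ) (rℂ.ρ w) = LinearMap.trace ℂ (Fin n → ℂ) (S.ρ w)) → S.N ≠ 0 → r₁.IsFrobSemisimplificationOf rℂ → ∀ f : (Fin n → ℂ) →ₗ[ℂ] (Fin n → ℂ), (∀ w : Literature.NumberTheory.GaloisRepresentations.WeilGroup (v.adicCompletion K), f ∘ₗ r₁.ρ w = ((Literature.NumberTheory.GaloisRepresentations.IsNonarchimedeanLocalField.residueFieldCard (v.adicCompletion K) : ℂ) ^ (Literature.NumberTheory.GaloisRepresentations.WeilGroup.deg w)) • (r₁.ρ w ∘ₗ f)) → f ∘ₗ r₁.N = r₁.N ∘ₗ f → f = 0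

/-- The unrestricted retention form Ret_p (sector `True`), recorded for the census. -/
def PadicMonodromyRetention : Prop :=
  ∀ (K : Type) [Field K] [NumberField K] (Rec : ReciprocityData K) (n : ℕ) (hcpt : Literature.NumberTheory.Automorphic.isCompact_glFiniteIntegralLevel n K), 0 < n → ∀ (π : Literature.NumberTheory.Automorphic.CuspidalAutomorphicRepData n K hcpt), π.1.IsLAlgebraic → ∀ (ℓ : ℕ) [Fact ℓ.Prime] (ι : PadicAlgCl ℓ ≃+* ℂ) (ρ : Literature.NumberTheory.GaloisRepresentations.FramedGaloisRep K (PadicAlgCl ℓ) n), ρ.toGaloisRep.IsIrreducible → ((∀ᶠ v : IsDedekindDomain.HeightOneSpectrum (NumberField.RingOfIntegers K) in Filter.cofinite, ρ.IsUnramifiedAt v) ∧ ∀ (v : IsDedekindDomain.HeightOneSpectrum (NumberField.RingOfIntegers K)) (hv : ((ℓ : ℕ) : NumberField.RingOfIntegers K) ∈ v.asIdeal), (Literature.NumberTheory.PAdicHodge.fontainePstAdicCompletion v ℓ hv).IsDeRhamFramed (ρ.toLocal v)) → (∀ᶠ v : IsDedekindDomain.HeightOneSpectrum (NumberField.RingOfIntegers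 K) in Filter.cofinite, SatakeFrobCompatibleAt ι π.1 ρ v) → ∀ (v : IsDedekindDomain.HeightOneSpectrum (NumberField.RingOfIntegers K)) (hv : ((ℓ : ℕ) : NumberField.RingOfIntegers K) ∈ v.asIdeal) (πv : Literature.NumberTheory.Automorphic.SmoothIrrep (Matrix.GeneralLinearGroup (Fin n) (v.adicCompletion K))), π.1.HasLocalComponentAt v πv.ρ → ∀ (r : Literature.NumberTheory.GaloisRepresentations.WeilDeligneRep (v.adicCompletion K) (PadicAlgCl ℓ) (Fin n → PadicAlgCl ℓ)) (rℂ r₁ : Literature.NumberTheory.GaloisRepresentations.WeilDeligneRep (v.adicCompletion K) ℂ (Fin n → ℂ)), (Literature.NumberTheory.PAdicHodge.fontainePstAdicCompletion v ℓ hv).IsWeilDeligneOf (ρ.toLocal v) r → r.IsTransportAlong (ι : PadicAlgCl ℓ →+* ℂ) rℂ → ∀ (S : Literature.NumberTheory.GaloisRepresentations.WeilDeligneRep (v.adicCompletion K) ℂ (Fin n → ℂ)) (hS : S.IsFrobSemisimple), Quotient.mk (Literature.NumberTheory.Automorphic.frobSemisimpleWDSetoid (v.adicCompletion K) n) ⟨S,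 hS⟩ = (Rec.llc v).recGL n (Literature.NumberTheory.Automorphic.IrrClass.mk πv) → (∀ w : Literature.NumberTheory.GaloisRepresentations.WeilGroup (v.adicCompletion K), LinearMap.trace ℂ (Fin n → ℂ) (rℂ.ρ w) = LinearMap.trace ℂ (Fin n → ℂ) (S.ρ w)) → S.N ≠ 0 → r₁.IsFrobSemisimplificationOf rℂ → ∀ f : (Fin n → ℂ) →ₗ[ℂ] (Fin n → ℂ), (∀ w : Literature.NumberTheory.GaloisRepresentations.WeilGroup (v.adicCompletion K), f ∘ₗ r₁.ρ w = ((Literature.NumberTheory.GaloisRepresentations.IsNonarchimedeanLocalField.residueFieldCard (v.adicCompletion K) : ℂ) ^ (Literature.NumberTheory.GaloisRepresentations.WeilGroup.deg w)) • (r₁.ρ w ∘ₗ f)) → f ∘ₗ r₁.N = r₁.N ∘ₗ f → f = 0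

/-- sector LOW (see the item docstrings in §1). -/
def secLOW : Sector :=
  fun K _ _ n _ π => ((∃ T : Literature.NumberTheory.Automorphic.InfinityType K n, π.1.HasInfinityType T ∧ T.IsLAlgebraic ∧ T.IsRegular) ∧ n ≤ 2 ∧ (NumberField.IsTotallyReal K ∨ (NumberField.IsCMField K ∧ (∃ T : Literature.NumberTheory.Automorphic.InfinityType K n, π.1.HasInfinityType T ∧ ∀ σ : K →+* ℂ, ∃ s : ℂ, (T σ).map Literature.NumberTheory.Automorphic.ArchWeight.a = (Literature.NumberTheory.Automorphic.weightZeroInfinityType n K σ).map (fun p => p.a + s)))))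

/-- sector CMH (see the item docstrings in §1). -/
def secCMH : Sector :=
  fun K _ _ n _ π => (NumberField.IsCMField K ∧ (∃ T : Literature.NumberTheory.Automorphic.InfinityType K n, π.1.HasInfinityType T ∧ T.IsLAlgebraic ∧ T.IsRegular) ∧ n ≤ 2 ∧ ¬ (∃ T : Literature.NumberTheory.Automorphic.InfinityType K n, π.1.HasInfinityType T ∧ ∀ σ : K →+* ℂ, ∃ s : ℂ, (T σ).map Literature.NumberTheory.Automorphic.ArchWeight.a = (Literature.NumberTheory.Automorphic.weightZeroInfinityType n K σ).map (fun p => p.a + s)))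

/-- sector HR (see the item docstrings in §1). -/
def secHR : Sector :=
  fun K _ _ n _ π => ((NumberField.IsTotallyReal K ∨ NumberField.IsCMField K) ∧ (∃ T : Literature.NumberTheory.Automorphic.InfinityType K n, π.1.HasInfinityType T ∧ T.IsLAlgebraic ∧ T.IsRegular) ∧ 3 ≤ n)

/-- sector DK (see the item docstrings in §1). -/
def secDK : Sector :=
  fun K _ _ n _ π => (¬ ((NumberField.IsTotallyReal K ∨ NumberField.IsCMField K) ∧ (∃ T : Literature.NumberTheory.Automorphic.InfinityType K n, π.1.HasInfinityType T ∧ T.IsLAlgebraic ∧ T.IsRegular)))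

/-- sector TR2 (see the item docstrings in §1). -/
def secTR2 : Sector :=
  fun K _ _ n _ π => (NumberField.IsTotallyReal K ∧ (∃ T : Literature.NumberTheory.Automorphic.InfinityType K n, π.1.HasInfinityType T ∧ T.IsLAlgebraic ∧ T.IsRegular) ∧ n ≤ 2)

/-- sector CMW (see the item docstrings in §1). -/
def secCMW : Sector :=
  fun K _ _ n _ π => (NumberField.IsCMField K ∧ (∃ T : Literature.NumberTheory.Automorphic.InfinityType K n, π.1.HasInfinityType T ∧ T.IsLAlgebraic ∧ T.IsRegular) ∧ n ≤ 2 ∧ (∃ T : Literature.NumberTheory.Automorphic.InfinityType K n, π.1.HasInfinityType T ∧ ∀ σ : K →+* ℂ, ∃ s : ℂ, (T σ).map Literature.NumberTheory.Automorphic.ArchWeight.a = (Literature.NumberTheory.Automorphic.weightZeroInfinityType n K σ).map (fun p => p.a + s)))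

/-! ## 1. The four pieces (items to be filed as the CHILDREN of GEN_p; texts inlined verbatim over the host vocabulary) -/

/-- [crux · child of GEN_p · NEW · WEAKER · PRINT modulo a Taylor–Wiles residue (closable by VENDOR + TRANSPORT;
residue INSTRUMENTABLE)] LOW — GEN_p (the pinned D_pst fibre of the irreducible Satake-compatible avatar ρ of π at v ∣ ℓ has
GENERIC Frobenius-semisimplification) RESTRICTED to the LOW sector: π of REGULAR L-algebraic infinity type, n ≤ 2, and EITHER K totally
real OR (K CM and π of weight zero up to an embedding-wise twist = parallel weight two). Members: n = 1 (N = 0; class field theory +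
Serre's algebraic Hecke characters); K totally real, n = 2: twists of paritious Hilbert newforms of weights ≥ 2 — PRINT: T. Saito,
Compos. Math. 145 (2009) 1081–1113 Thm 1; C. Skinner, Doc. Math. 14 (2009) 241–258 (the remaining even-degree principal-series case,
N ≠ 0 at Steinberg places above p); T. Liu, JIMJ 11 (2012); Blasius–Rogawski 1993. K CM, n = 2, parallel weight two: polarisable-type π
(base change from K⁺ up to twist, CM-induced) — the totally real case + Caraiani, Algebra Number Theory 8 (2014) Thm 1.1; NON-polarisable π —
Y. Yang, arXiv:2407.00288 (2024) Thm 3.1 (ℓ ≥ 5 unramified in K, r̄ decomposed generic with enormous image) / Thm 1.1 (density-one set of ℓ),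
by the ℓ = p Allen–Newton–Luu functoriality argument (A'Campo 2024 + Hevesi 2023 + FL lifting ACC⁺23 6.1.1 + HBAV AN20 3.9 + genericity).
RESIDUE (census instrument I-g18.1): the CM triples (K, π, ℓ) failing Yang's hypotheses. Node sub-cells TR2 (K totally real) ∧ CMW (K CM)
⟺ LOW (kernel `low_iff_fine`). Retention kernel (node): modulo S_p ∧ RECGEN ∧ MFR ∧ CRD the cell's only content is at the places
v ∣ ℓ with rec(π_v) MONODROMIC (π_v special). -/
def TotallyRealOrCMWeightTwoRankTwoFibreAtP : Prop :=
  ∀ (K : Type) [Field K] [NumberField K] (n : ℕ) (hcpt : Literature.NumberTheory.Automorphic.isCompact_glFiniteIntegralLevel n K), 0 < n → ∀ (π : Literature.NumberTheory.Automorphic.CuspidalAutomorphicRepData n K hcpt), π.1.IsLAlgebraic → ((∃ T : Literature.NumberTheory.Automorphic.InfinityType K n, π.1.HasInfinityType T ∧ T.IsLAlgebraic ∧ T.IsRegular) ∧ n ≤ 2 ∧ (NumberField.IsTotallyReal K ∨ (NumberField.IsCMField K ∧ (∃ T : Literature.NumberTheory.Automorphic.InfinityType K n, π.1.HasInfinityType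 T ∧ ∀ σ : K →+* ℂ, ∃ s : ℂ, (T σ).map Literature.NumberTheory.Automorphic.ArchWeight.a = (Literature.NumberTheory.Automorphic.weightZeroInfinityType n K σ).map (fun p => p.a + s))))) → ∀ (ℓ : ℕ) [Fact ℓ.Prime] (ι : PadicAlgCl ℓ ≃+* ℂ) (ρ : Literature.NumberTheory.GaloisRepresentations.FramedGaloisRep K (PadicAlgCl ℓ) n), ρ.toGaloisRep.IsIrreducible → ((∀ᶠ v : IsDedekindDomain.HeightOneSpectrum (NumberField.RingOfIntegers K) in Filter.cofinite, ρ.IsUnramifiedAt v) ∧ ∀ (v : IsDedekindDomain.HeightOneSpectrum (NumberField.RingOfIntegers K)) (hv : ((ℓ : ℕ) : NumberField.RingOfIntegers K) ∈ v.asIdeal), (Literature.NumberTheory.PAdicHodge.fontainePstAdicCompletion v ℓ hv).IsDeRhamFramed (ρ.toLocal v)) → (∀ᶠ v : IsDedekindDomain.HeightOneSpectrum (NumberField.RingOfIntegers K) in Filter.cofinite, SatakeFrobCompatibleAt ι π.1 ρ v) → ∀ (v : IsDedekindDomain.HeightOneSpectrum (NumberField.RingOfIntegers K)) (hv : ((ℓ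 : ℕ) : NumberField.RingOfIntegers K) ∈ v.asIdeal), ∀ (r : Literature.NumberTheory.GaloisRepresentations.WeilDeligneRep (v.adicCompletion K) (PadicAlgCl ℓ) (Fin n → PadicAlgCl ℓ)) (rℂ r₁ : Literature.NumberTheory.GaloisRepresentations.WeilDeligneRep (v.adicCompletion K) ℂ (Fin n → ℂ)), (Literature.NumberTheory.PAdicHodge.fontainePstAdicCompletion v ℓ hv).IsWeilDeligneOf (ρ.toLocal v) r → r.IsTransportAlong (ι : PadicAlgCl ℓ →+* ℂ) rℂ → r₁.IsFrobSemisimplificationOf rℂ → ∀ f : (Fin n → ℂ) →ₗ[ℂ] (Fin n → ℂ), (∀ w : Literature.NumberTheory.GaloisRepresentations.WeilGroup (v.adicCompletion K), f ∘ₗ r₁.ρ w = ((Literature.NumberTheory.GaloisRepresentations.IsNonarchimedeanLocalField.residueFieldCard (v.adicCompletion K) : ℂ) ^ (Literature.NumberTheory.GaloisRepresentations.WeilGroup.deg w)) • (r₁.ρ w ∘ₗ f)) → f ∘ₗ r₁.N = r₁.N ∘ₗ f → f = 0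

/-- identity: the filed text of LOW IS `GenAt secLOW`. -/
theorem low_iff_genAt : TotallyRealOrCMWeightTwoRankTwoFibreAtP ↔ GenAt secLOW := Iff.rfl

/-- [crux · child of GEN_p · NEW · WEAKER · OPEN = «YANG'S GAP» · IDEA-NEEDED · idea-on-ledger · ATTACKED] CMH —
GEN_p RESTRICTED to K CM, π regular L-algebraic, n ≤ 2 (so n = 2: for n = 1 the weight dial is vacuous), π NOT of weight zero up to
twist (non-parallel or higher regular weight). Polarisable-type members are print (base change of higher-weight Hilbert newforms: Saito 2009 /
Skinner 2009 / Liu 2012 + GL₁; Caraiani 2014); the NON-POLARISABLE members are OPEN — Yang 2024 §1 (arXiv:2407.00288): the Fontaine–Laffaille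
lifting theorem (ACC⁺23 Thm 6.1.1) allows no change of weight and HBAV potential automorphy (AN20 Thm 3.9) outputs weight 0 only, while the
ordinary lifting theorem (ACC⁺23 Thm 6.1.2, used at ℓ ≠ p in Yang 2021) does not keep the lift unramified above ℓ, «essential for the proof»;
a special π_v of non-zero cohomological weight is never ordinary at v. By AHTW 2026 Thm 1.2.1 / Hevesi 2023 the semisimple part and N_Gal ≼ N_aut
are print, so (retention kernel, node) modulo S_p ∧ RECGEN ∧ MFR ∧ CRD the cell IS: «for K CM, π cuspidal non-polarisable on GL₂(𝔸_K) of
regular non-parallel weight with π_v SPECIAL at v ∣ ℓ, r_ι(π)|Γ_{K_v} is not potentially crystalline (N ≠ 0 on D_pst)». Idea on the ledger: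
route-Langlands-SteinbergVelocityDst (DORMANT) crux `MaximalMonodromyDst` stmt-Langlands-14047 («N is the derivative of the p-adic family along
the weight direction», Steinberg-type v ∣ p with 2[K_v:ℚ_p] ≤ [K:ℚ]); second idea: weight-changing ℓ = p lifting with level control at ℓ
(Matsumoto-at-p, named open by Yang 2024 §1). INSIDE `MonodromyNotClosedUnderPadicLimits` (technique class; its v ∣ ℓ twin = scope caveat (a)): the avatars are p-adic limits of
polarisable ones and N ≠ 0 is open, not closed, in families; the cell is exactly where the catalogued evasion (ii) (automorphy lifting with v
removed from the level: Luu / Allen–Newton / Yang) runs out, and evasions (iii) p-adic Mazur principle / (iv) a lower bound on rk N are untried. -/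
def CMHigherWeightRankTwoFibreAtP : Prop :=
  ∀ (K : Type) [Field K] [NumberField K] (n : ℕ) (hcpt : Literature.NumberTheory.Automorphic.isCompact_glFiniteIntegralLevel n K), 0 < n → ∀ (π : Literature.NumberTheory.Automorphic.CuspidalAutomorphicRepData n K hcpt), π.1.IsLAlgebraic → (NumberField.IsCMField K ∧ (∃ T : Literature.NumberTheory.Automorphic.InfinityType K n, π.1.HasInfinityType T ∧ T.IsLAlgebraic ∧ T.IsRegular) ∧ n ≤ 2 ∧ ¬ (∃ T : Literature.NumberTheory.Automorphic.InfinityType K n, π.1.HasInfinityType T ∧ ∀ σ : K →+* ℂ, ∃ s : ℂ, (T σ).map Literature.NumberTheory.Automorphic.ArchWeight.a = (Literature.NumberTheory.Automorphic.weightZeroInfinityType n K σ).map (fun p => p.a + s))) → ∀ (ℓ : ℕ) [Fact ℓ.Prime] (ι : PadicAlgCl ℓ ≃+* ℂ) (ρ : Literature.NumberTheory.GaloisRepresentations.FramedGaloisRep K (PadicAlgCl ℓ) n), ρ.toGaloisRep.IsIrreducible → ((∀ᶠ v : IsDedekindDomain.HeightOneSpectrum (NumberField.RingOfIntegers K) in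 Filter.cofinite, ρ.IsUnramifiedAt v) ∧ ∀ (v : IsDedekindDomain.HeightOneSpectrum (NumberField.RingOfIntegers K)) (hv : ((ℓ : ℕ) : NumberField.RingOfIntegers K) ∈ v.asIdeal), (Literature.NumberTheory.PAdicHodge.fontainePstAdicCompletion v ℓ hv).IsDeRhamFramed (ρ.toLocal v)) → (∀ᶠ v : IsDedekindDomain.HeightOneSpectrum (NumberField.RingOfIntegers K) in Filter.cofinite, SatakeFrobCompatibleAt ι π.1 ρ v) → ∀ (v : IsDedekindDomain.HeightOneSpectrum (NumberField.RingOfIntegers K)) (hv : ((ℓ : ℕ) : NumberField.RingOfIntegers K) ∈ v.asIdeal), ∀ (r : Literature.NumberTheory.GaloisRepresentations.WeilDeligneRep (v.adicCompletion K) (PadicAlgCl ℓ) (Fin n → PadicAlgCl ℓ)) (rℂ r₁ : Literature.NumberTheory.GaloisRepresentations.WeilDeligneRep (v.adicCompletion K) ℂ (Fin n → ℂ)), (Literature.NumberTheory.PAdicHodge.fontainePstAdicCompletion v ℓ hv).IsWeilDeligneOf (ρ.toLocal v) r → r.IsTransportAlong (ι : PadicAlgCl ℓ →+* ℂ) rℂ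 → r₁.IsFrobSemisimplificationOf rℂ → ∀ f : (Fin n → ℂ) →ₗ[ℂ] (Fin n → ℂ), (∀ w : Literature.NumberTheory.GaloisRepresentations.WeilGroup (v.adicCompletion K), f ∘ₗ r₁.ρ w = ((Literature.NumberTheory.GaloisRepresentations.IsNonarchimedeanLocalField.residueFieldCard (v.adicCompletion K) : ℂ) ^ (Literature.NumberTheory.GaloisRepresentations.WeilGroup.deg w)) • (r₁.ρ w ∘ₗ f)) → f ∘ₗ r₁.N = r₁.N ∘ₗ f → f = 0

/-- identity: the filed text of CMH IS `GenAt secCMH`. -/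
theorem cmh_iff_genAt : CMHigherWeightRankTwoFibreAtP ↔ GenAt secCMH := Iff.rfl

/-- [crux · child of GEN_p · NEW · WEAKER · MIXED: polarisable sub-sector PRINT / non-polarisable OPEN · IDEA-NEEDED] HR —
GEN_p RESTRICTED to K totally real or CM, π regular L-algebraic, n ≥ 3. Polarisable (essentially (conjugate-)self-dual up to twist) π: PRINT —
A. Caraiani, Algebra Number Theory 8 (2014) 1597–1646 Thm 1.1 (ℓ = p local–global compatibility INCLUDING N for RACSDC π: Shimura varieties +
Taylor–Yoshida at p; Duke 161 (2012) for ℓ ≠ p), BLGGT 2014 for the essentially-self-dual bookkeeping, totally real K by quadratic base change.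
NON-polarisable π (HLTT/Scholze torsion-built avatars): semisimple part print for CM K (AHTW 2026 arXiv:2607.11763 Thm 1.2.1, with N_Gal ≼ N_aut),
EQUALITY OF MONODROMY OPEN — Yang 2024 §1: needs non-polarisable weight-0 potential automorphy beyond GL₂ with level control at ℓ («if
Matsumoto's method can be translated to ℓ = p»; Matsumoto 2023 did ℓ ≠ p, Qian 2023 potential automorphy for GL_n). Idea on the ledger for
Steinberg-type places: SteinbergVelocityDst.MaximalMonodromyDst 14047 (n ≥ 3: every v ∣ p qualifies). INSIDE `MonodromyNotClosedUnderPadicLimits`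
(v ∣ ℓ twin, scope caveat (a); evasion (i) geometry = exactly the polarisable sub-sector) and `PatchingLocalComponentBarrier` (intermediate nilpotent orbits invisible to patched-module support). Retention kernel (node):
content only at monodromic π_v, v ∣ ℓ. -/
def HigherRankRegularFibreAtP : Prop :=
  ∀ (K : Type) [Field K] [NumberField K] (n : ℕ) (hcpt : Literature.NumberTheory.Automorphic.isCompact_glFiniteIntegralLevel n K), 0 < n → ∀ (π : Literature.NumberTheory.Automorphic.CuspidalAutomorphicRepData n K hcpt), π.1.IsLAlgebraic → ((NumberField.IsTotallyReal K ∨ NumberField.IsCMField K) ∧ (∃ T : Literature.NumberTheory.Automorphic.InfinityType K n, π.1.HasInfinityType T ∧ T.IsLAlgebraic ∧ T.IsRegular) ∧ 3 ≤ n) → ∀ (ℓ : ℕ) [Fact ℓ.Prime] (ι : PadicAlgCl ℓ ≃+* ℂ) (ρ : Literature.NumberTheory.GaloisRepresentations.FramedGaloisRep K (PadicAlgCl ℓ) n), ρ.toGaloisRep.IsIrreducible → ((∀ᶠ v : IsDedekindDomain.HeightOneSpectrum (NumberField.RingOfIntegers K) in Filter.cofinite, ρ.IsUnramifiedAt v)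 ∧ ∀ (v : IsDedekindDomain.HeightOneSpectrum (NumberField.RingOfIntegers K)) (hv : ((ℓ : ℕ) : NumberField.RingOfIntegers K) ∈ v.asIdeal), (Literature.NumberTheory.PAdicHodge.fontainePstAdicCompletion v ℓ hv).IsDeRhamFramed (ρ.toLocal v)) → (∀ᶠ v : IsDedekindDomain.HeightOneSpectrum (NumberField.RingOfIntegers K) in Filter.cofinite, SatakeFrobCompatibleAt ι π.1 ρ v) → ∀ (v : IsDedekindDomain.HeightOneSpectrum (NumberField.RingOfIntegers K)) (hv : ((ℓ : ℕ) : NumberField.RingOfIntegers K) ∈ v.asIdeal), ∀ (r : Literature.NumberTheory.GaloisRepresentations.WeilDeligneRep (v.adicCompletion K) (PadicAlgCl ℓ) (Fin n → PadicAlgCl ℓ)) (rℂ r₁ : Literature.NumberTheory.GaloisRepresentations.WeilDeligneRep (v.adicCompletion K) ℂ (Fin n → ℂ)), (Literature.NumberTheory.PAdicHodge.fontainePstAdicCompletion v ℓ hv).IsWeilDeligneOf (ρ.toLocal v) r → r.IsTransportAlong (ι : PadicAlgCl ℓ →+* ℂ) rℂ → r₁.IsFrobSemisimplificationOf rℂ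 → ∀ f : (Fin n → ℂ) →ₗ[ℂ] (Fin n → ℂ), (∀ w : Literature.NumberTheory.GaloisRepresentations.WeilGroup (v.adicCompletion K), f ∘ₗ r₁.ρ w = ((Literature.NumberTheory.GaloisRepresentations.IsNonarchimedeanLocalField.residueFieldCard (v.adicCompletion K) : ℂ) ^ (Literature.NumberTheory.GaloisRepresentations.WeilGroup.deg w)) • (r₁.ρ w ∘ₗ f)) → f ∘ₗ r₁.N = r₁.N ∘ₗ f → f = 0

/-- identity: the filed text of HR IS `GenAt secHR`. -/
theorem hr_iff_genAt : HigherRankRegularFibreAtP ↔ GenAt secHR := Iff.rfl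

/-- [crux · child of GEN_p · NEW · WEAKER · DECLARED RESIDUAL of this split · BARRIER-CERTIFIED] DK — GEN_p RESTRICTED to the DARK
sector: K neither totally real nor CM, OR π not of regular L-algebraic infinity type. Conditional content only: the avatar ρ is a HYPOTHESIS of
GEN_p, and off the bright sector no avatar is known to exist (W⁺ = SatakeAvatarExistence 17415 is dark there: `ShimuraVarietyRealizationBarrier`,
`TaylorWilesNumericalCoincidence`, `NonRegularWeightBarrier`); where irregular avatars do exist (n = 2 partial weight one over totally real K,
built by congruences; weight-(1,…,1) Artin-type) even de Rham-ness at p (DR 26480) is not in print in general, let alone the monodromy of D_pst.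
Not staffed; counted ONCE with the summit's dark residual (same population as RetentionCarving.ThetaDarkRetention 29947 at v ∤ ℓ and
PolarisationCarving.NonTRCMTypeAutomorphy 32054 on the (B) side). -/
def DarkFibreAtP : Prop :=
  ∀ (K : Type) [Field K] [NumberField K] (n : ℕ) (hcpt : Literature.NumberTheory.Automorphic.isCompact_glFiniteIntegralLevel n K), 0 < n → ∀ (π : Literature.NumberTheory.Automorphic.CuspidalAutomorphicRepData n K hcpt), π.1.IsLAlgebraic → (¬ ((NumberField.IsTotallyReal K ∨ NumberField.IsCMField K) ∧ (∃ T : Literature.NumberTheory.Automorphic.InfinityType K n, π.1.HasInfinityType T ∧ T.IsLAlgebraic ∧ T.IsRegular))) → ∀ (ℓ : ℕ) [Fact ℓ.Prime] (ι : PadicAlgCl ℓ ≃+* ℂ) (ρ : Literature.NumberTheory.GaloisRepresentations.FramedGaloisRep K (PadicAlgCl ℓ) n), ρ.toGaloisRep.IsIrreducible → ((∀ᶠ v : IsDedekindDomain.HeightOneSpectrum (NumberField.RingOfIntegers K) in Filter.cofinite, ρ.IsUnramifiedAt v) ∧ ∀ (v : IsDedekindDomain.HeightOneSpectrum (NumberField.RingOfIntegers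 K)) (hv : ((ℓ : ℕ) : NumberField.RingOfIntegers K) ∈ v.asIdeal), (Literature.NumberTheory.PAdicHodge.fontainePstAdicCompletion v ℓ hv).IsDeRhamFramed (ρ.toLocal v)) → (∀ᶠ v : IsDedekindDomain.HeightOneSpectrum (NumberField.RingOfIntegers K) in Filter.cofinite, SatakeFrobCompatibleAt ι π.1 ρ v) → ∀ (v : IsDedekindDomain.HeightOneSpectrum (NumberField.RingOfIntegers K)) (hv : ((ℓ : ℕ) : NumberField.RingOfIntegers K) ∈ v.asIdeal), ∀ (r : Literature.NumberTheory.GaloisRepresentations.WeilDeligneRep (v.adicCompletion K) (PadicAlgCl ℓ) (Fin n → PadicAlgCl ℓ)) (rℂ r₁ : Literature.NumberTheory.GaloisRepresentations.WeilDeligneRep (v.adicCompletion K) ℂ (Fin n → ℂ)), (Literature.NumberTheory.PAdicHodge.fontainePstAdicCompletion v ℓ hv).IsWeilDeligneOf (ρ.toLocal v) r → r.IsTransportAlong (ι : PadicAlgCl ℓ →+* ℂ) rℂ → r₁.IsFrobSemisimplificationOf rℂ → ∀ f : (Fin n → ℂ) →ₗ[ℂ] (Fin n → ℂ), (∀ w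 : Literature.NumberTheory.GaloisRepresentations.WeilGroup (v.adicCompletion K), f ∘ₗ r₁.ρ w = ((Literature.NumberTheory.GaloisRepresentations.IsNonarchimedeanLocalField.residueFieldCard (v.adicCompletion K) : ℂ) ^ (Literature.NumberTheory.GaloisRepresentations.WeilGroup.deg w)) • (r₁.ρ w ∘ₗ f)) → f ∘ₗ r₁.N = r₁.N ∘ₗ f → f = 0

/-- identity: the filed text of DK IS `GenAt secDK`. -/
theorem dk_iff_genAt : DarkFibreAtP ↔ GenAt secDK := Iff.rfl

/-! ### 1b. Node sub-cells of LOW (finer census; not filed because of the 15-item cap) -/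

/-- [node sub-cell of LOW · PRINT] TR2 — GEN_p restricted to K totally real, π regular L-algebraic, n ≤ 2 (Saito 2009 / Skinner 2009 / Liu 2012; n = 1 CFT). -/
def TotallyRealRankTwoFibreAtP : Prop :=
  ∀ (K : Type) [Field K] [NumberField K] (n : ℕ) (hcpt : Literature.NumberTheory.Automorphic.isCompact_glFiniteIntegralLevel n K), 0 < n → ∀ (π : Literature.NumberTheory.Automorphic.CuspidalAutomorphicRepData n K hcpt), π.1.IsLAlgebraic → (NumberField.IsTotallyReal K ∧ (∃ T : Literature.NumberTheory.Automorphic.InfinityType K n, π.1.HasInfinityType T ∧ T.IsLAlgebraic ∧ T.IsRegular) ∧ n ≤ 2) → ∀ (ℓ : ℕ) [Fact ℓ.Prime] (ι : PadicAlgCl ℓ ≃+* ℂ) (ρ : Literature.NumberTheory.GaloisRepresentations.FramedGaloisRep K (PadicAlgCl ℓ) n), ρ.toGaloisRep.IsIrreducible → ((∀ᶠ v : IsDedekindDomain.HeightOneSpectrum (NumberField.RingOfIntegers K) in Filter.cofinite, ρ.IsUnramifiedAt v) ∧ ∀ (v : IsDedekindDomain.HeightOneSpectrum (NumberField.RingOfIntegers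 K)) (hv : ((ℓ : ℕ) : NumberField.RingOfIntegers K) ∈ v.asIdeal), (Literature.NumberTheory.PAdicHodge.fontainePstAdicCompletion v ℓ hv).IsDeRhamFramed (ρ.toLocal v)) → (∀ᶠ v : IsDedekindDomain.HeightOneSpectrum (NumberField.RingOfIntegers K) in Filter.cofinite, SatakeFrobCompatibleAt ι π.1 ρ v) → ∀ (v : IsDedekindDomain.HeightOneSpectrum (NumberField.RingOfIntegers K)) (hv : ((ℓ : ℕ) : NumberField.RingOfIntegers K) ∈ v.asIdeal), ∀ (r : Literature.NumberTheory.GaloisRepresentations.WeilDeligneRep (v.adicCompletion K) (PadicAlgCl ℓ) (Fin n → PadicAlgCl ℓ)) (rℂ r₁ : Literature.NumberTheory.GaloisRepresentations.WeilDeligneRep (v.adicCompletion K) ℂ (Fin n → ℂ)), (Literature.NumberTheory.PAdicHodge.fontainePstAdicCompletion v ℓ hv).IsWeilDeligneOf (ρ.toLocal v) r → r.IsTransportAlong (ι : PadicAlgCl ℓ →+* ℂ) rℂ → r₁.IsFrobSemisimplificationOf rℂ → ∀ f : (Fin n → ℂ) →ₗ[ℂ] (Fin n → ℂ), (∀ w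 : Literature.NumberTheory.GaloisRepresentations.WeilGroup (v.adicCompletion K), f ∘ₗ r₁.ρ w = ((Literature.NumberTheory.GaloisRepresentations.IsNonarchimedeanLocalField.residueFieldCard (v.adicCompletion K) : ℂ) ^ (Literature.NumberTheory.GaloisRepresentations.WeilGroup.deg w)) • (r₁.ρ w ∘ₗ f)) → f ∘ₗ r₁.N = r₁.N ∘ₗ f → f = 0

theorem tr2_iff_genAt : TotallyRealRankTwoFibreAtP ↔ GenAt secTR2 := Iff.rfl

/-- [node sub-cell of LOW · PRINT mod TW-residue] CMW — GEN_p restricted to K CM, π regular L-algebraic of parallel weight two up to twist, n ≤ 2 (Caraiani 2014 polarisable; Yang 2024 Thm 1.1/3.1 non-polarisable). -/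
def CMWeightTwoRankTwoFibreAtP : Prop :=
  ∀ (K : Type) [Field K] [NumberField K] (n : ℕ) (hcpt : Literature.NumberTheory.Automorphic.isCompact_glFiniteIntegralLevel n K), 0 < n → ∀ (π : Literature.NumberTheory.Automorphic.CuspidalAutomorphicRepData n K hcpt), π.1.IsLAlgebraic → (NumberField.IsCMField K ∧ (∃ T : Literature.NumberTheory.Automorphic.InfinityType K n, π.1.HasInfinityType T ∧ T.IsLAlgebraic ∧ T.IsRegular) ∧ n ≤ 2 ∧ (∃ T : Literature.NumberTheory.Automorphic.InfinityType K n, π.1.HasInfinityType T ∧ ∀ σ : K →+* ℂ, ∃ s : ℂ, (T σ).map Literature.NumberTheory.Automorphic.ArchWeight.a = (Literature.NumberTheory.Automorphic.weightZeroInfinityType n K σ).map (fun p => p.a + s))) → ∀ (ℓ : ℕ) [Fact ℓ.Prime] (ι : PadicAlgCl ℓ ≃+* ℂ) (ρ : Literature.NumberTheory.GaloisRepresentations.FramedGaloisRep K (PadicAlgCl ℓ) n), ρ.toGaloisRep.IsIrreducible → ((∀ᶠ v : IsDedekindDomain.HeightOneSpectrum (NumberField.RingOfIntegers K) in Filter.cofinite,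 ρ.IsUnramifiedAt v) ∧ ∀ (v : IsDedekindDomain.HeightOneSpectrum (NumberField.RingOfIntegers K)) (hv : ((ℓ : ℕ) : NumberField.RingOfIntegers K) ∈ v.asIdeal), (Literature.NumberTheory.PAdicHodge.fontainePstAdicCompletion v ℓ hv).IsDeRhamFramed (ρ.toLocal v)) → (∀ᶠ v : IsDedekindDomain.HeightOneSpectrum (NumberField.RingOfIntegers K) in Filter.cofinite, SatakeFrobCompatibleAt ι π.1 ρ v) → ∀ (v : IsDedekindDomain.HeightOneSpectrum (NumberField.RingOfIntegers K)) (hv : ((ℓ : ℕ) : NumberField.RingOfIntegers K) ∈ v.asIdeal), ∀ (r : Literature.NumberTheory.GaloisRepresentations.WeilDeligneRep (v.adicCompletion K) (PadicAlgCl ℓ) (Fin n → PadicAlgCl ℓ)) (rℂ r₁ : Literature.NumberTheory.GaloisRepresentations.WeilDeligneRep (v.adicCompletion K) ℂ (Fin n → ℂ)), (Literature.NumberTheory.PAdicHodge.fontainePstAdicCompletion v ℓ hv).IsWeilDeligneOf (ρ.toLocal v) r → r.IsTransportAlong (ι : PadicAlgCl ℓ →+* ℂ) rℂ → r₁.IsFrobSemisimplificationOf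 rℂ → ∀ f : (Fin n → ℂ) →ₗ[ℂ] (Fin n → ℂ), (∀ w : Literature.NumberTheory.GaloisRepresentations.WeilGroup (v.adicCompletion K), f ∘ₗ r₁.ρ w = ((Literature.NumberTheory.GaloisRepresentations.IsNonarchimedeanLocalField.residueFieldCard (v.adicCompletion K) : ℂ) ^ (Literature.NumberTheory.GaloisRepresentations.WeilGroup.deg w)) • (r₁.ρ w ∘ₗ f)) → f ∘ₗ r₁.N = r₁.N ∘ₗ f → f = 0

theorem cmw_iff_genAt : CMWeightTwoRankTwoFibreAtP ↔ GenAt secCMW := Iff.rfl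

/-- The split glue (item `GenericFibreAtP_of_split`, pure logic): the four cells recompose GEN_p — excluded middle on the inlined
dials «bright sector (K TR ∨ CM) ∧ π regular», «n ≤ 2 ∨ 3 ≤ n», and for CM K of rank ≤ 2 «weight zero up to twist or not». -/
theorem GenericFibreAtP_of_split :
    TotallyRealOrCMWeightTwoRankTwoFibreAtP → CMHigherWeightRankTwoFibreAtP → HigherRankRegularFibreAtP → DarkFibreAtP →
      RootDecomp2.GenericFibreAtP := by
  intro hLOW hCMH hHR hDK K _ _ n hcpt hn π hL
  by_cases hb : ((NumberField.IsTotallyReal K ∨ NumberField.IsCMField K) ∧ (∃ T : Literature.NumberTheory.Automorphic.InfinityType K n, π.1.HasInfinityType T ∧ T.IsLAlgebraic ∧ T.IsRegular))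
  · obtain ⟨hTC, hreg⟩ := hb
    by_cases h2 : n ≤ 2
    · rcases hTC with hT | hC
      · exact hLOW K n hcpt hn π hL ⟨hreg, h2, Or.inl hT⟩
      · by_cases hg : (∃ T : Literature.NumberTheory.Automorphic.InfinityType K n, π.1.HasInfinityType T ∧ ∀ σ : K →+* ℂ, ∃ s : ℂ, (T σ).map Literature.NumberTheory.Automorphic.ArchWeight.a = (Literature.NumberTheory.Automorphic.weightZeroInfinityType n K σ).map (fun p => p.a + s))
        · exact hLOW K n hcpt hn π hL ⟨hreg, h2, Or.inr ⟨hC, hg⟩⟩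
        · exact hCMH K n hcpt hn π hL ⟨hC, hreg, h2, hg⟩
    · exact hHR K n hcpt hn π hL ⟨hTC, hreg, by omega⟩
  · exact hDK K n hcpt hn π hL hb

/-- WEAKER certificates: each cell is GEN_p with hypotheses added. -/
theorem low_of_genericFibreAtP (h : RootDecomp2.GenericFibreAtP) : TotallyRealOrCMWeightTwoRankTwoFibreAtP :=
  fun K _ _ n hcpt hn π hL _ => h K n hcpt hn π hL
theorem cmh_of_genericFibreAtP (h : RootDecomp2.GenericFibreAtP) : CMHigherWeightRankTwoFibreAtP :=
  fun K _ _ n hcpt hn π hL _ => h K n hcpt hn π hL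
theorem hr_of_genericFibreAtP (h : RootDecomp2.GenericFibreAtP) : HigherRankRegularFibreAtP :=
  fun K _ _ n hcpt hn π hL _ => h K n hcpt hn π hL
theorem dk_of_genericFibreAtP (h : RootDecomp2.GenericFibreAtP) : DarkFibreAtP :=
  fun K _ _ n hcpt hn π hL _ => h K n hcpt hn π hL

/-- EXACTNESS (costume census K1): the carving is exact modulo NOTHING. -/
theorem genericFibreAtP_iff_cells :
    RootDecomp2.GenericFibreAtP ↔
      (TotallyRealOrCMWeightTwoRankTwoFibreAtP ∧ CMHigherWeightRankTwoFibreAtP ∧ HigherRankRegularFibreAtP ∧ DarkFibreAtP) :=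
  ⟨fun h => ⟨low_of_genericFibreAtP h, cmh_of_genericFibreAtP h, hr_of_genericFibreAtP h, dk_of_genericFibreAtP h⟩,
    fun h => GenericFibreAtP_of_split h.1 h.2.1 h.2.2.1 h.2.2.2⟩

/-- LOW ⟺ its two node sub-cells (K totally real / K CM of parallel weight two). -/
theorem low_iff_fine :
    TotallyRealOrCMWeightTwoRankTwoFibreAtP ↔ (TotallyRealRankTwoFibreAtP ∧ CMWeightTwoRankTwoFibreAtP) := by
  refine ⟨fun h => ⟨fun K _ _ n hcpt hn π hL hs => h K n hcpt hn π hL ⟨hs.2.1, hs.2.2, Or.inl hs.1⟩,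
    fun K _ _ n hcpt hn π hL hs => h K n hcpt hn π hL ⟨hs.2.1, hs.2.2.1, Or.inr ⟨hs.1, hs.2.2.2⟩⟩⟩, fun h K _ _ n hcpt hn π hL hs => ?_⟩
  rcases hs.2.2 with hT | ⟨hC, hg⟩
  · exact h.1 K n hcpt hn π hL ⟨hT, hs.1, hs.2.1⟩
  · exact h.2 K n hcpt hn π hL ⟨hC, hs.1, hs.2.1, hg⟩

/-- GEN_p itself is `GenAt ⊤` up to the trivial hypothesis. -/
theorem genericFibreAtP_iff_genAt_top : RootDecomp2.GenericFibreAtP ↔ GenAt (fun _ _ _ _ _ _ => True) :=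
  ⟨fun h K _ _ n hcpt hn π hL _ => h K n hcpt hn π hL, fun h K _ _ n hcpt hn π hL => h K n hcpt hn π hL trivial⟩

/-! ## 2. Retention layer (the lens-6 barrier-complement certificate): N = 0 places are closed modulo the host items -/

/-- WEAKER: the retention form follows from the fibre form on every sector (drop the automorphic-side data). -/
theorem retAt_of_genAt (P : Sector) (h : GenAt P) : RetAt P := by
  intro K _ _ Rec n hcpt hn π hL hP ℓ _ ι ρ hirr hgeo hsat v hv πv hπv r rℂ r₁ hr hι S hS hcl htr hN0 hr₁
  exact h K n hcpt hn π hL hP ℓ ι ρ hirr hgeo hsat v hv r rℂ r₁ hr hι hr₁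

/-- The retention kernel, uniformly in the sector: CRD ∧ S_p ∧ RECGEN (host items BY NAME) ∧ MFR (PROVED in the tree,
`Theorems.MonodromyFreeRigidity_proof`) ∧ RetAt P ⟹ GenAt P.  At a place v ∣ ℓ: S_p supplies a local component π_v and a pinned
fibre r' with ℂ-transport rℂ' trace-matched to every S ∈ rec_v(π_v); Fontaine's fibre is unique up to isomorphism
(`PstWeilDeligneData.isWeilDeligneOf_isEquivalent`), so ANY pinned fibre r with transport rℂ is trace-matched to S
(`Aux.isTransportAlong_trace_eq`, `Aux.isEquivalent_trace_eq`); if S.N = 0, RECGEN makes S generic, monodromy-free rigidity identifies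
the Frobenius-semisimplification r₁ of rℂ with S, so r₁ lies in the class rec_v(π_v) and RECGEN applied to r₁ makes it generic;
if S.N ≠ 0 this is RetAt P. -/
theorem genAt_of_retAt (P : Sector) (hR : RootDecomp2.CanonicalReciprocityData) (hSp : RootDecomp2.SemisimpleMatchingAtP)
    (hRG : RootDecomp2.RecPreservesGenericity) (hRet : RetAt P) : GenAt P := by
  intro K _ _ n hcpt hn π hL hP ℓ _ ι ρ hirr hgeo hsat v hv r rℂ r₁ hr hι hr₁
  obtain ⟨Rec⟩ := hR K
  obtain ⟨πv, r', rℂ', hπv, hr', hι', htrS'⟩ := hSp K Rec n hcpt hn π hL ℓ ι ρ hirr hgeo hsat v hv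
  obtain ⟨⟨S, hS⟩, hcl⟩ := Quotient.exists_rep
    ((Rec.llc v).recGL n (Literature.NumberTheory.Automorphic.IrrClass.mk πv))
  -- Fontaine's fibre is unique up to isomorphism: r ≅ r'
  have hrr' : r.IsEquivalent r' :=
    Literature.NumberTheory.GaloisRepresentations.PstWeilDeligneData.isWeilDeligneOf_isEquivalent _ (ρ.toLocal v) hr hr'
  -- hence rℂ is trace-matched to S as well
  have htr : ∀ w : Literature.NumberTheory.GaloisRepresentations.WeilGroup (v.adicCompletion K),
      LinearMap.trace ℂ (Fin n → ℂ) (rℂ.ρ w) = LinearMap.trace ℂ (Fin n → ℂ) (S.ρ w) := by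
    intro w
    rw [Aux.isTransportAlong_trace_eq hι w, Aux.isEquivalent_trace_eq hrr' w, ← Aux.isTransportAlong_trace_eq hι' w]
    exact htrS' S hS hcl w
  by_cases hN0 : S.N = 0
  · -- N = 0 place: MFR identifies the Frobenius-semisimplification r₁ with S, so r₁ lies in the rec class and RECGEN applies to r₁
    have htr₁ : ∀ w : Literature.NumberTheory.GaloisRepresentations.WeilGroup (v.adicCompletion K),
        LinearMap.trace ℂ (Fin n → ℂ) (r₁.ρ w) = LinearMap.trace ℂ (Fin n → ℂ) (S.ρ w) := fun w => by
      rw [Aux.frobSemisimplification_trace_eq hr₁ w]; exact htr w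
    have hgS := hRG K Rec n hcpt hn π hL v πv hπv S hS hcl
    obtain ⟨-, ⟨e⟩⟩ := Summit.Langlands.Langlands.Theorems.MonodromyFreeRigidity_proof (v.adicCompletion K) n S r₁ hS
      hr₁.isFrobSemisimple (fun w => (htr₁ w).symm) hN0 hgS
    have hcl₁ : Quotient.mk (Literature.NumberTheory.Automorphic.frobSemisimpleWDSetoid (v.adicCompletion K) n)
        ⟨r₁, hr₁.isFrobSemisimple⟩ = (Rec.llc v).recGL n (Literature.NumberTheory.Automorphic.IrrClass.mk πv) := by
      rw [← hcl]
      exact Quotient.sound ⟨e.symm⟩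
    exact hRG K Rec n hcpt hn π hL v πv hπv r₁ hr₁.isFrobSemisimple hcl₁
  · exact hRet K Rec n hcpt hn π hL hP ℓ ι ρ hirr hgeo hsat v hv πv hπv r rℂ r₁ hr hι S hS hcl htr hN0 hr₁

/-- Corollary: GEN_p ⟸ CRD ∧ S_p ∧ RECGEN ∧ Ret_p (MFR proved) — GEN_p's only content modulo the host items is at the
monodromic places above ℓ. -/
theorem genericFibreAtP_of_retention (hR : RootDecomp2.CanonicalReciprocityData) (hSp : RootDecomp2.SemisimpleMatchingAtP)
    (hRG : RootDecomp2.RecPreservesGenericity) (hRet : PadicMonodromyRetention) : RootDecomp2.GenericFibreAtP :=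
  genericFibreAtP_iff_genAt_top.2 (genAt_of_retAt _ hR hSp hRG
    (fun K _ _ Rec n hcpt hn π hL _ => hRet K Rec n hcpt hn π hL))

/-- … and conversely Ret_p is WEAKER than GEN_p. -/
theorem padicMonodromyRetention_of_genericFibreAtP (h : RootDecomp2.GenericFibreAtP) : PadicMonodromyRetention :=
  fun K _ _ Rec n hcpt hn π hL => retAt_of_genAt _ (genericFibreAtP_iff_genAt_top.1 h) K Rec n hcpt hn π hL trivial

/-- Per-cell retention: each filed cell ⟸ host items ∧ its retention form (e.g. the attacked cell CMH). -/
theorem cmh_of_retention (hR : RootDecomp2.CanonicalReciprocityData) (hSp : RootDecomp2.SemisimpleMatchingAtP)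
    (hRG : RootDecomp2.RecPreservesGenericity) (hRet : RetAt secCMH) : CMHigherWeightRankTwoFibreAtP :=
  genAt_of_retAt secCMH hR hSp hRG hRet
theorem hr_of_retention (hR : RootDecomp2.CanonicalReciprocityData) (hSp : RootDecomp2.SemisimpleMatchingAtP)
    (hRG : RootDecomp2.RecPreservesGenericity) (hRet : RetAt secHR) : HigherRankRegularFibreAtP :=
  genAt_of_retAt secHR hR hSp hRG hRet
theorem low_of_retention (hR : RootDecomp2.CanonicalReciprocityData) (hSp : RootDecomp2.SemisimpleMatchingAtP)
    (hRG : RootDecomp2.RecPreservesGenericity) (hRet : RetAt secLOW) : TotallyRealOrCMWeightTwoRankTwoFibreAtP :=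
  genAt_of_retAt secLOW hR hSp hRG hRet
theorem dk_of_retention (hR : RootDecomp2.CanonicalReciprocityData) (hSp : RootDecomp2.SemisimpleMatchingAtP)
    (hRG : RootDecomp2.RecPreservesGenericity) (hRet : RetAt secDK) : DarkFibreAtP :=
  genAt_of_retAt secDK hR hSp hRG hRet
/-- … and the retention form of each cell is WEAKER than the cell. -/
theorem retention_of_cmh (h : CMHigherWeightRankTwoFibreAtP) : RetAt secCMH := retAt_of_genAt secCMH h

/-! ## 3. Deciding theorem: the host route with GEN_p replaced by its four cells -/

/-- `closes`: RootDecomp2's binders with GEN_p (26482) replaced by LOW ∧ CMH ∧ HR ∧ DK ⟹ `_root_.Langlands`, through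
`RootDecomp2.closes` BY NAME (rev 0). -/
theorem closes (hB : RootDecomp2.WeakGeometricAutomorphy) (hW : RootDecomp2.SatakeAvatarExistence)
    (hA : RootDecomp2.CompatibilityAwayFromLR) (hDR : RootDecomp2.DeRhamMember) (hSp : RootDecomp2.SemisimpleMatchingAtP)
    (hLOW : TotallyRealOrCMWeightTwoRankTwoFibreAtP) (hCMH : CMHigherWeightRankTwoFibreAtP) (hHR : HigherRankRegularFibreAtP)
    (hDK : DarkFibreAtP) (hRG : RootDecomp2.RecPreservesGenericity) (hWDU : RootDecomp2.GenericWDUnique)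
    (hR : RootDecomp2.CanonicalReciprocityData) : _root_.Langlands :=
  RootDecomp2.closes hB hW hA hDR hSp (GenericFibreAtP_of_split hLOW hCMH hHR hDK) hRG hWDU hR

/-- Retention variant of `closes`: the cells in RETENTION form suffice (MFR is a theorem; CRD, S_p, RECGEN are host binders). -/
theorem closes_retention (hB : RootDecomp2.WeakGeometricAutomorphy) (hW : RootDecomp2.SatakeAvatarExistence)
    (hA : RootDecomp2.CompatibilityAwayFromLR) (hDR : RootDecomp2.DeRhamMember) (hSp : RootDecomp2.SemisimpleMatchingAtP)
    (hLOW : RetAt secLOW) (hCMH : RetAt secCMH) (hHR : RetAt secHR) (hDK : RetAt secDK)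
    (hRG : RootDecomp2.RecPreservesGenericity) (hWDU : RootDecomp2.GenericWDUnique)
    (hR : RootDecomp2.CanonicalReciprocityData) : _root_.Langlands :=
  closes hB hW hA hDR hSp (genAt_of_retAt _ hR hSp hRG hLOW) (genAt_of_retAt _ hR hSp hRG hCMH)
    (genAt_of_retAt _ hR hSp hRG hHR) (genAt_of_retAt _ hR hSp hRG hDK) hRG hWDU hR

/-- The same with the fine sub-cells of LOW. -/
theorem closes_fine (hB : RootDecomp2.WeakGeometricAutomorphy) (hW : RootDecomp2.SatakeAvatarExistence)
    (hA : RootDecomp2.CompatibilityAwayFromLR) (hDR : RootDecomp2.DeRhamMember) (hSp : RootDecomp2.SemisimpleMatchingAtP)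
    (hTR2 : TotallyRealRankTwoFibreAtP) (hCMW : CMWeightTwoRankTwoFibreAtP) (hCMH : CMHigherWeightRankTwoFibreAtP)
    (hHR : HigherRankRegularFibreAtP) (hDK : DarkFibreAtP) (hRG : RootDecomp2.RecPreservesGenericity)
    (hWDU : RootDecomp2.GenericWDUnique) (hR : RootDecomp2.CanonicalReciprocityData) : _root_.Langlands :=
  closes hB hW hA hDR hSp (low_iff_fine.2 ⟨hTR2, hCMW⟩) hCMH hHR hDK hRG hWDU hR

/-! ## 5. BC3-style BIRTH SKELETON for the ATTACKED cell CMH (this file only; the node file `PadicFibreCarving.lean` is sorry-free)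
CMH ⟸ CRD ∧ S_p ∧ RECGEN (host items) ∧ stub_nonCrystallineAtSpecial (L, load-bearing, OPEN) ∧ stub_rankTwoMonodromicGeneric (M, local algebra),
via the retention kernel `cmh_of_retention` (MFR proved).  Evasion (iv) of `MonodromyNotClosedUnderPadicLimits`: an INDEPENDENT LOWER BOUND on rk N. -/

/-- stub (L · load-bearing · OPEN = Yang's gap at ℓ = p): in the CMH sector (K CM, n ≤ 2, π regular of non-parallel weight), at a place
v ∣ ℓ where rec_v(π_v) is MONODROMIC (S.N ≠ 0, i.e. π_v special), the Frobenius-semisimplification r₁ of the ℂ-transport of the pinned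
D_pst fibre of ρ has r₁.N ≠ 0 — «r_ι(π)|Γ_{K_v} is not potentially crystalline up to twist when π_v is special».  Sources: Yang 2024 §1
(open beyond weight 0); idea on the ledger SteinbergVelocityDst.MaximalMonodromyDst 14047; Skinner 2009 §2 (the totally real analogue via
p-adic families + Kisin); 𝓛-invariant / companion-point lower bounds (barrier evasion (iv)). -/
theorem stub_nonCrystallineAtSpecial :
    ∀ (K : Type) [Field K] [NumberField K] (Rec : ReciprocityData K) (n : ℕ) (hcpt : Literature.NumberTheory.Automorphic.isCompact_glFiniteIntegralLevel n K), 0 < n → ∀ (π : Literature.NumberTheory.Automorphic.CuspidalAutomorphicRepData n K hcpt), π.1.IsLAlgebraic → (NumberField.IsCMField K ∧ (∃ T : Literature.NumberTheory.Automorphic.InfinityType K n, π.1.HasInfinityType T ∧ T.IsLAlgebraic ∧ T.IsRegular) ∧ n ≤ 2 ∧ ¬ (∃ T : Literature.NumberTheory.Automorphic.InfinityType K n, π.1.HasInfinityType T ∧ ∀ σ : K →+* ℂ, ∃ s : ℂ, (T σ).map Literature.NumberTheory.Automorphic.ArchWeight.a = (Literature.NumberTheory.Automorphic.weightZeroInfinityType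 n K σ).map (fun p => p.a + s))) → ∀ (ℓ : ℕ) [Fact ℓ.Prime] (ι : PadicAlgCl ℓ ≃+* ℂ) (ρ : Literature.NumberTheory.GaloisRepresentations.FramedGaloisRep K (PadicAlgCl ℓ) n), ρ.toGaloisRep.IsIrreducible → ((∀ᶠ v : IsDedekindDomain.HeightOneSpectrum (NumberField.RingOfIntegers K) in Filter.cofinite, ρ.IsUnramifiedAt v) ∧ ∀ (v : IsDedekindDomain.HeightOneSpectrum (NumberField.RingOfIntegers K)) (hv : ((ℓ : ℕ) : NumberField.RingOfIntegers K) ∈ v.asIdeal), (Literature.NumberTheory.PAdicHodge.fontainePstAdicCompletion v ℓ hv).IsDeRhamFramed (ρ.toLocal v)) → (∀ᶠ v : IsDedekindDomain.HeightOneSpectrum (NumberField.RingOfIntegers K) in Filter.cofinite, SatakeFrobCompatibleAt ι π.1 ρ v) → ∀ (v : IsDedekindDomain.HeightOneSpectrum (NumberField.RingOfIntegers K)) (hv : ((ℓ : ℕ) : NumberField.RingOfIntegers K) ∈ v.asIdeal) (πv : Literature.NumberTheory.Automorphic.SmoothIrrep (Matrix.GeneralLinearGroup (Fin n) (v.adicCompletion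 K))), π.1.HasLocalComponentAt v πv.ρ → ∀ (r : Literature.NumberTheory.GaloisRepresentations.WeilDeligneRep (v.adicCompletion K) (PadicAlgCl ℓ) (Fin n → PadicAlgCl ℓ)) (rℂ r₁ : Literature.NumberTheory.GaloisRepresentations.WeilDeligneRep (v.adicCompletion K) ℂ (Fin n → ℂ)), (Literature.NumberTheory.PAdicHodge.fontainePstAdicCompletion v ℓ hv).IsWeilDeligneOf (ρ.toLocal v) r → r.IsTransportAlong (ι : PadicAlgCl ℓ →+* ℂ) rℂ → ∀ (S : Literature.NumberTheory.GaloisRepresentations.WeilDeligneRep (v.adicCompletion K) ℂ (Fin n → ℂ)) (hS : S.IsFrobSemisimple), Quotient.mk (Literature.NumberTheory.Automorphic.frobSemisimpleWDSetoid (v.adicCompletion K) n) ⟨S, hS⟩ = (Rec.llc v).recGL n (Literature.NumberTheory.Automorphic.IrrClass.mk πv) → (∀ w : Literature.NumberTheory.GaloisRepresentations.WeilGroup (v.adicCompletion K), LinearMap.trace ℂ (Fin n → ℂ) (rℂ.ρ w) = LinearMap.trace ℂ (Fin n → ℂ) (S.ρ w)) → S.N ≠ 0 → r₁.IsFrobSemisimplificationOf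 rℂ → r₁.N ≠ 0 := by
  sorry

/-- stub (M · local algebra, rank ≤ 2): with the same data, r₁.N ≠ 0 forces r₁ to be GENERIC — for n = 1 the hypothesis S.N ≠ 0 is absurd;
for n = 2 a Frobenius-semisimple (ρ, N) with N ≠ 0 is of Steinberg type χ ⊗ Sp₂ (N-equivariance pins ρ^{ss} = χ‖·‖ ⊕ χ), which is generic
(the tree's `steinbergWD` one-orbit lemmas in `Literature.Barriers.Langlands.MonodromyNotClosedUnderPadicLimits` §3; Allen 2016 Lemma 1.1.3). -/
theorem stub_rankTwoMonodromicGeneric :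
    ∀ (K : Type) [Field K] [NumberField K] (Rec : ReciprocityData K) (n : ℕ) (hcpt : Literature.NumberTheory.Automorphic.isCompact_glFiniteIntegralLevel n K), 0 < n → ∀ (π : Literature.NumberTheory.Automorphic.CuspidalAutomorphicRepData n K hcpt), π.1.IsLAlgebraic → (NumberField.IsCMField K ∧ (∃ T : Literature.NumberTheory.Automorphic.InfinityType K n, π.1.HasInfinityType T ∧ T.IsLAlgebraic ∧ T.IsRegular) ∧ n ≤ 2 ∧ ¬ (∃ T : Literature.NumberTheory.Automorphic.InfinityType K n, π.1.HasInfinityType T ∧ ∀ σ : K →+* ℂ, ∃ s : ℂ, (T σ).map Literature.NumberTheory.Automorphic.ArchWeight.a = (Literature.NumberTheory.Automorphic.weightZeroInfinityType n K σ).map (fun p => p.a + s))) → ∀ (ℓ : ℕ) [Fact ℓ.Prime] (ι : PadicAlgCl ℓ ≃+* ℂ) (ρ : Literature.NumberTheory.GaloisRepresentations.FramedGaloisRep K (PadicAlgCl ℓ) n), ρ.toGaloisRep.IsIrreducible → ((∀ᶠ v : IsDedekindDomain.HeightOneSpectrum (NumberField.RingOfIntegers K) in Filter.cofinite, ρ.IsUnramifiedAt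 v) ∧ ∀ (v : IsDedekindDomain.HeightOneSpectrum (NumberField.RingOfIntegers K)) (hv : ((ℓ : ℕ) : NumberField.RingOfIntegers K) ∈ v.asIdeal), (Literature.NumberTheory.PAdicHodge.fontainePstAdicCompletion v ℓ hv).IsDeRhamFramed (ρ.toLocal v)) → (∀ᶠ v : IsDedekindDomain.HeightOneSpectrum (NumberField.RingOfIntegers K) in Filter.cofinite, SatakeFrobCompatibleAt ι π.1 ρ v) → ∀ (v : IsDedekindDomain.HeightOneSpectrum (NumberField.RingOfIntegers K)) (hv : ((ℓ : ℕ) : NumberField.RingOfIntegers K) ∈ v.asIdeal) (πv : Literature.NumberTheory.Automorphic.SmoothIrrep (Matrix.GeneralLinearGroup (Fin n) (v.adicCompletion K))), π.1.HasLocalComponentAt v πv.ρ → ∀ (r : Literature.NumberTheory.GaloisRepresentations.WeilDeligneRep (v.adicCompletion K) (PadicAlgCl ℓ) (Fin n → PadicAlgCl ℓ)) (rℂ r₁ : Literature.NumberTheory.GaloisRepresentations.WeilDeligneRep (v.adicCompletion K) ℂ (Fin n → ℂ)), (Literature.NumberTheory.PAdicHodge.fontainePstAdicCompletion v ℓ hv).IsWeilDeligneOf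 (ρ.toLocal v) r → r.IsTransportAlong (ι : PadicAlgCl ℓ →+* ℂ) rℂ → ∀ (S : Literature.NumberTheory.GaloisRepresentations.WeilDeligneRep (v.adicCompletion K) ℂ (Fin n → ℂ)) (hS : S.IsFrobSemisimple), Quotient.mk (Literature.NumberTheory.Automorphic.frobSemisimpleWDSetoid (v.adicCompletion K) n) ⟨S, hS⟩ = (Rec.llc v).recGL n (Literature.NumberTheory.Automorphic.IrrClass.mk πv) → (∀ w : Literature.NumberTheory.GaloisRepresentations.WeilGroup (v.adicCompletion K), LinearMap.trace ℂ (Fin n → ℂ) (rℂ.ρ w) = LinearMap.trace ℂ (Fin n → ℂ) (S.ρ w)) → S.N ≠ 0 → r₁.IsFrobSemisimplificationOf rℂ → r₁.N ≠ 0 → ∀ f : (Fin n → ℂ) →ₗ[ℂ] (Fin n → ℂ), (∀ w : Literature.NumberTheory.GaloisRepresentations.WeilGroup (v.adicCompletion K), f ∘ₗ r₁.ρ w = ((Literature.NumberTheory.GaloisRepresentations.IsNonarchimedeanLocalField.residueFieldCard (v.adicCompletion K) : ℂ) ^ (Literature.NumberTheory.GaloisRepresentations.WeilGroup.deg w)) •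 (r₁.ρ w ∘ₗ f)) → f ∘ₗ r₁.N = r₁.N ∘ₗ f → f = 0 := by
  sorry

/-- composition (kernel-checked): the two stubs give the retention form of CMH … -/
theorem cmhRetention_of_stubs
    (h₁ : ∀ (K : Type) [Field K] [NumberField K] (Rec : ReciprocityData K) (n : ℕ) (hcpt : Literature.NumberTheory.Automorphic.isCompact_glFiniteIntegralLevel n K), 0 < n → ∀ (π : Literature.NumberTheory.Automorphic.CuspidalAutomorphicRepData n K hcpt), π.1.IsLAlgebraic → (NumberField.IsCMField K ∧ (∃ T : Literature.NumberTheory.Automorphic.InfinityType K n, π.1.HasInfinityType T ∧ T.IsLAlgebraic ∧ T.IsRegular) ∧ n ≤ 2 ∧ ¬ (∃ T : Literature.NumberTheory.Automorphic.InfinityType K n, π.1.HasInfinityType T ∧ ∀ σ : K →+* ℂ, ∃ s : ℂ, (T σ).map Literature.NumberTheory.Automorphic.ArchWeight.a = (Literature.NumberTheory.Automorphic.weightZeroInfinityType n K σ).map (fun p => p.a + s))) → ∀ (ℓ : ℕ) [Fact ℓ.Prime] (ι : PadicAlgCl ℓ ≃+* ℂ) (ρ : Literature.NumberTheory.GaloisRepresentations.FramedGaloisRep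 K (PadicAlgCl ℓ) n), ρ.toGaloisRep.IsIrreducible → ((∀ᶠ v : IsDedekindDomain.HeightOneSpectrum (NumberField.RingOfIntegers K) in Filter.cofinite, ρ.IsUnramifiedAt v) ∧ ∀ (v : IsDedekindDomain.HeightOneSpectrum (NumberField.RingOfIntegers K)) (hv : ((ℓ : ℕ) : NumberField.RingOfIntegers K) ∈ v.asIdeal), (Literature.NumberTheory.PAdicHodge.fontainePstAdicCompletion v ℓ hv).IsDeRhamFramed (ρ.toLocal v)) → (∀ᶠ v : IsDedekindDomain.HeightOneSpectrum (NumberField.RingOfIntegers K) in Filter.cofinite, SatakeFrobCompatibleAt ι π.1 ρ v) → ∀ (v : IsDedekindDomain.HeightOneSpectrum (NumberField.RingOfIntegers K)) (hv : ((ℓ : ℕ) : NumberField.RingOfIntegers K) ∈ v.asIdeal) (πv : Literature.NumberTheory.Automorphic.SmoothIrrep (Matrix.GeneralLinearGroup (Fin n) (v.adicCompletion K))), π.1.HasLocalComponentAt v πv.ρ → ∀ (r : Literature.NumberTheory.GaloisRepresentations.WeilDeligneRep (v.adicCompletion K) (PadicAlgCl ℓ) (Fin n → PadicAlgCl ℓ))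 (rℂ r₁ : Literature.NumberTheory.GaloisRepresentations.WeilDeligneRep (v.adicCompletion K) ℂ (Fin n → ℂ)), (Literature.NumberTheory.PAdicHodge.fontainePstAdicCompletion v ℓ hv).IsWeilDeligneOf (ρ.toLocal v) r → r.IsTransportAlong (ι : PadicAlgCl ℓ →+* ℂ) rℂ → ∀ (S : Literature.NumberTheory.GaloisRepresentations.WeilDeligneRep (v.adicCompletion K) ℂ (Fin n → ℂ)) (hS : S.IsFrobSemisimple), Quotient.mk (Literature.NumberTheory.Automorphic.frobSemisimpleWDSetoid (v.adicCompletion K) n) ⟨S, hS⟩ = (Rec.llc v).recGL n (Literature.NumberTheory.Automorphic.IrrClass.mk πv) → (∀ w : Literature.NumberTheory.GaloisRepresentations.WeilGroup (v.adicCompletion K), LinearMap.trace ℂ (Fin n → ℂ) (rℂ.ρ w) = LinearMap.trace ℂ (Fin n → ℂ) (S.ρ w)) → S.N ≠ 0 → r₁.IsFrobSemisimplificationOf rℂ → r₁.N ≠ 0)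
    (h₂ : ∀ (K : Type) [Field K] [NumberField K] (Rec : ReciprocityData K) (n : ℕ) (hcpt : Literature.NumberTheory.Automorphic.isCompact_glFiniteIntegralLevel n K), 0 < n → ∀ (π : Literature.NumberTheory.Automorphic.CuspidalAutomorphicRepData n K hcpt), π.1.IsLAlgebraic → (NumberField.IsCMField K ∧ (∃ T : Literature.NumberTheory.Automorphic.InfinityType K n, π.1.HasInfinityType T ∧ T.IsLAlgebraic ∧ T.IsRegular) ∧ n ≤ 2 ∧ ¬ (∃ T : Literature.NumberTheory.Automorphic.InfinityType K n, π.1.HasInfinityType T ∧ ∀ σ : K →+* ℂ, ∃ s : ℂ, (T σ).map Literature.NumberTheory.Automorphic.ArchWeight.a = (Literature.NumberTheory.Automorphic.weightZeroInfinityType n K σ).map (fun p => p.a + s))) → ∀ (ℓ : ℕ) [Fact ℓ.Prime] (ι : PadicAlgCl ℓ ≃+* ℂ) (ρ : Literature.NumberTheory.GaloisRepresentations.FramedGaloisRep K (PadicAlgCl ℓ) n), ρ.toGaloisRep.IsIrreducible → ((∀ᶠ v : IsDedekindDomain.HeightOneSpectrum (NumberField.RingOfIntegers K) in Filter.cofinite,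 ρ.IsUnramifiedAt v) ∧ ∀ (v : IsDedekindDomain.HeightOneSpectrum (NumberField.RingOfIntegers K)) (hv : ((ℓ : ℕ) : NumberField.RingOfIntegers K) ∈ v.asIdeal), (Literature.NumberTheory.PAdicHodge.fontainePstAdicCompletion v ℓ hv).IsDeRhamFramed (ρ.toLocal v)) → (∀ᶠ v : IsDedekindDomain.HeightOneSpectrum (NumberField.RingOfIntegers K) in Filter.cofinite, SatakeFrobCompatibleAt ι π.1 ρ v) → ∀ (v : IsDedekindDomain.HeightOneSpectrum (NumberField.RingOfIntegers K)) (hv : ((ℓ : ℕ) : NumberField.RingOfIntegers K) ∈ v.asIdeal) (πv : Literature.NumberTheory.Automorphic.SmoothIrrep (Matrix.GeneralLinearGroup (Fin n) (v.adicCompletion K))), π.1.HasLocalComponentAt v πv.ρ → ∀ (r : Literature.NumberTheory.GaloisRepresentations.WeilDeligneRep (v.adicCompletion K) (PadicAlgCl ℓ) (Fin n → PadicAlgCl ℓ)) (rℂ r₁ : Literature.NumberTheory.GaloisRepresentations.WeilDeligneRep (v.adicCompletion K) ℂ (Fin n → ℂ)), (Literature.NumberTheory.PAdicHodge.fontainePstAdicCompletion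 v ℓ hv).IsWeilDeligneOf (ρ.toLocal v) r → r.IsTransportAlong (ι : PadicAlgCl ℓ →+* ℂ) rℂ → ∀ (S : Literature.NumberTheory.GaloisRepresentations.WeilDeligneRep (v.adicCompletion K) ℂ (Fin n → ℂ)) (hS : S.IsFrobSemisimple), Quotient.mk (Literature.NumberTheory.Automorphic.frobSemisimpleWDSetoid (v.adicCompletion K) n) ⟨S, hS⟩ = (Rec.llc v).recGL n (Literature.NumberTheory.Automorphic.IrrClass.mk πv) → (∀ w : Literature.NumberTheory.GaloisRepresentations.WeilGroup (v.adicCompletion K), LinearMap.trace ℂ (Fin n → ℂ) (rℂ.ρ w) = LinearMap.trace ℂ (Fin n → ℂ) (S.ρ w)) → S.N ≠ 0 → r₁.IsFrobSemisimplificationOf rℂ → r₁.N ≠ 0 → ∀ f : (Fin n → ℂ) →ₗ[ℂ] (Fin n → ℂ), (∀ w : Literature.NumberTheory.GaloisRepresentations.WeilGroup (v.adicCompletion K), f ∘ₗ r₁.ρ w = ((Literature.NumberTheory.GaloisRepresentations.IsNonarchimedeanLocalField.residueFieldCard (v.adicCompletion K) : ℂ) ^ (Literature.NumberTheory.GaloisRepresentations.WeilGroup.deg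 w)) • (r₁.ρ w ∘ₗ f)) → f ∘ₗ r₁.N = r₁.N ∘ₗ f → f = 0) :
    RetAt secCMH := by
  intro K _ _ Rec n hcpt hn π hL hP ℓ _ ι ρ hirr hgeo hsat v hv πv hπv r rℂ r₁ hr hι S hS hcl htr hN0 hr₁
  exact h₂ K Rec n hcpt hn π hL hP ℓ ι ρ hirr hgeo hsat v hv πv hπv r rℂ r₁ hr hι S hS hcl htr hN0 hr₁
    (h₁ K Rec n hcpt hn π hL hP ℓ ι ρ hirr hgeo hsat v hv πv hπv r rℂ r₁ hr hι S hS hcl htr hN0 hr₁)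

/-- … hence CMH itself, given the host items CRD, S_p, RECGEN (MFR is a theorem). -/
theorem CMHigherWeightRankTwoFibreAtP_of (hR : RootDecomp2.CanonicalReciprocityData) (hSp : RootDecomp2.SemisimpleMatchingAtP)
    (hRG : RootDecomp2.RecPreservesGenericity)
    (h₁ : ∀ (K : Type) [Field K] [NumberField K] (Rec : ReciprocityData K) (n : ℕ) (hcpt : Literature.NumberTheory.Automorphic.isCompact_glFiniteIntegralLevel n K), 0 < n → ∀ (π : Literature.NumberTheory.Automorphic.CuspidalAutomorphicRepData n K hcpt), π.1.IsLAlgebraic → (NumberField.IsCMField K ∧ (∃ T : Literature.NumberTheory.Automorphic.InfinityType K n, π.1.HasInfinityType T ∧ T.IsLAlgebraic ∧ T.IsRegular) ∧ n ≤ 2 ∧ ¬ (∃ T : Literature.NumberTheory.Automorphic.InfinityType K n, π.1.HasInfinityType T ∧ ∀ σ : K →+* ℂ, ∃ s : ℂ, (T σ).map Literature.NumberTheory.Automorphic.ArchWeight.a = (Literature.NumberTheory.Automorphic.weightZeroInfinityType n K σ).map (fun p => p.a + s))) → ∀ (ℓ : ℕ) [Fact ℓ.Prime] (ι : PadicAlgCl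 ℓ ≃+* ℂ) (ρ : Literature.NumberTheory.GaloisRepresentations.FramedGaloisRep K (PadicAlgCl ℓ) n), ρ.toGaloisRep.IsIrreducible → ((∀ᶠ v : IsDedekindDomain.HeightOneSpectrum (NumberField.RingOfIntegers K) in Filter.cofinite, ρ.IsUnramifiedAt v) ∧ ∀ (v : IsDedekindDomain.HeightOneSpectrum (NumberField.RingOfIntegers K)) (hv : ((ℓ : ℕ) : NumberField.RingOfIntegers K) ∈ v.asIdeal), (Literature.NumberTheory.PAdicHodge.fontainePstAdicCompletion v ℓ hv).IsDeRhamFramed (ρ.toLocal v)) → (∀ᶠ v : IsDedekindDomain.HeightOneSpectrum (NumberField.RingOfIntegers K) in Filter.cofinite, SatakeFrobCompatibleAt ι π.1 ρ v) → ∀ (v : IsDedekindDomain.HeightOneSpectrum (NumberField.RingOfIntegers K)) (hv : ((ℓ : ℕ) : NumberField.RingOfIntegers K) ∈ v.asIdeal) (πv : Literature.NumberTheory.Automorphic.SmoothIrrep (Matrix.GeneralLinearGroup (Fin n) (v.adicCompletion K))), π.1.HasLocalComponentAt v πv.ρ → ∀ (r : Literature.NumberTheory.GaloisRepresentations.WeilDeligneRep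 (v.adicCompletion K) (PadicAlgCl ℓ) (Fin n → PadicAlgCl ℓ)) (rℂ r₁ : Literature.NumberTheory.GaloisRepresentations.WeilDeligneRep (v.adicCompletion K) ℂ (Fin n → ℂ)), (Literature.NumberTheory.PAdicHodge.fontainePstAdicCompletion v ℓ hv).IsWeilDeligneOf (ρ.toLocal v) r → r.IsTransportAlong (ι : PadicAlgCl ℓ →+* ℂ) rℂ → ∀ (S : Literature.NumberTheory.GaloisRepresentations.WeilDeligneRep (v.adicCompletion K) ℂ (Fin n → ℂ)) (hS : S.IsFrobSemisimple), Quotient.mk (Literature.NumberTheory.Automorphic.frobSemisimpleWDSetoid (v.adicCompletion K) n) ⟨S, hS⟩ = (Rec.llc v).recGL n (Literature.NumberTheory.Automorphic.IrrClass.mk πv) → (∀ w : Literature.NumberTheory.GaloisRepresentations.WeilGroup (v.adicCompletion K), LinearMap.trace ℂ (Fin n → ℂ) (rℂ.ρ w) = LinearMap.trace ℂ (Fin n → ℂ) (S.ρ w)) → S.N ≠ 0 → r₁.IsFrobSemisimplificationOf rℂ → r₁.N ≠ 0)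
    (h₂ : ∀ (K : Type) [Field K] [NumberField K] (Rec : ReciprocityData K) (n : ℕ) (hcpt : Literature.NumberTheory.Automorphic.isCompact_glFiniteIntegralLevel n K), 0 < n → ∀ (π : Literature.NumberTheory.Automorphic.CuspidalAutomorphicRepData n K hcpt), π.1.IsLAlgebraic → (NumberField.IsCMField K ∧ (∃ T : Literature.NumberTheory.Automorphic.InfinityType K n, π.1.HasInfinityType T ∧ T.IsLAlgebraic ∧ T.IsRegular) ∧ n ≤ 2 ∧ ¬ (∃ T : Literature.NumberTheory.Automorphic.InfinityType K n, π.1.HasInfinityType T ∧ ∀ σ : K →+* ℂ, ∃ s : ℂ, (T σ).map Literature.NumberTheory.Automorphic.ArchWeight.a = (Literature.NumberTheory.Automorphic.weightZeroInfinityType n K σ).map (fun p => p.a + s))) → ∀ (ℓ : ℕ) [Fact ℓ.Prime] (ι : PadicAlgCl ℓ ≃+* ℂ) (ρ : Literature.NumberTheory.GaloisRepresentations.FramedGaloisRep K (PadicAlgCl ℓ) n), ρ.toGaloisRep.IsIrreducible → ((∀ᶠ v : IsDedekindDomain.HeightOneSpectrum (NumberField.RingOfIntegers K) in Filter.cofinite,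 ρ.IsUnramifiedAt v) ∧ ∀ (v : IsDedekindDomain.HeightOneSpectrum (NumberField.RingOfIntegers K)) (hv : ((ℓ : ℕ) : NumberField.RingOfIntegers K) ∈ v.asIdeal), (Literature.NumberTheory.PAdicHodge.fontainePstAdicCompletion v ℓ hv).IsDeRhamFramed (ρ.toLocal v)) → (∀ᶠ v : IsDedekindDomain.HeightOneSpectrum (NumberField.RingOfIntegers K) in Filter.cofinite, SatakeFrobCompatibleAt ι π.1 ρ v) → ∀ (v : IsDedekindDomain.HeightOneSpectrum (NumberField.RingOfIntegers K)) (hv : ((ℓ : ℕ) : NumberField.RingOfIntegers K) ∈ v.asIdeal) (πv : Literature.NumberTheory.Automorphic.SmoothIrrep (Matrix.GeneralLinearGroup (Fin n) (v.adicCompletion K))), π.1.HasLocalComponentAt v πv.ρ → ∀ (r : Literature.NumberTheory.GaloisRepresentations.WeilDeligneRep (v.adicCompletion K) (PadicAlgCl ℓ) (Fin n → PadicAlgCl ℓ)) (rℂ r₁ : Literature.NumberTheory.GaloisRepresentations.WeilDeligneRep (v.adicCompletion K) ℂ (Fin n → ℂ)), (Literature.NumberTheory.PAdicHodge.fontainePstAdicCompletion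 v ℓ hv).IsWeilDeligneOf (ρ.toLocal v) r → r.IsTransportAlong (ι : PadicAlgCl ℓ →+* ℂ) rℂ → ∀ (S : Literature.NumberTheory.GaloisRepresentations.WeilDeligneRep (v.adicCompletion K) ℂ (Fin n → ℂ)) (hS : S.IsFrobSemisimple), Quotient.mk (Literature.NumberTheory.Automorphic.frobSemisimpleWDSetoid (v.adicCompletion K) n) ⟨S, hS⟩ = (Rec.llc v).recGL n (Literature.NumberTheory.Automorphic.IrrClass.mk πv) → (∀ w : Literature.NumberTheory.GaloisRepresentations.WeilGroup (v.adicCompletion K), LinearMap.trace ℂ (Fin n → ℂ) (rℂ.ρ w) = LinearMap.trace ℂ (Fin n → ℂ) (S.ρ w)) → S.N ≠ 0 → r₁.IsFrobSemisimplificationOf rℂ → r₁.N ≠ 0 → ∀ f : (Fin n → ℂ) →ₗ[ℂ] (Fin n → ℂ), (∀ w : Literature.NumberTheory.GaloisRepresentations.WeilGroup (v.adicCompletion K), f ∘ₗ r₁.ρ w = ((Literature.NumberTheory.GaloisRepresentations.IsNonarchimedeanLocalField.residueFieldCard (v.adicCompletion K) : ℂ) ^ (Literature.NumberTheory.GaloisRepresentations.WeilGroup.deg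 w)) • (r₁.ρ w ∘ₗ f)) → f ∘ₗ r₁.N = r₁.N ∘ₗ f → f = 0) :
    CMHigherWeightRankTwoFibreAtP :=
  cmh_of_retention hR hSp hRG (cmhRetention_of_stubs h₁ h₂)

theorem CMHigherWeightRankTwoFibreAtP_of_stubs (hR : RootDecomp2.CanonicalReciprocityData) (hSp : RootDecomp2.SemisimpleMatchingAtP)
    (hRG : RootDecomp2.RecPreservesGenericity) : CMHigherWeightRankTwoFibreAtP :=
  CMHigherWeightRankTwoFibreAtP_of hR hSp hRG stub_nonCrystallineAtSpecial stub_rankTwoMonodromicGeneric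

end Summit.Langlands.Langlands.Theses.PadicFibreCarving
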